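import Mathlib
import Literature.NumberTheory.LFunctions.Zhang2022.Section2SmoothWeight
import Literature.NumberTheory.LFunctions.Zhang2022.Section5Lemma54DeltaDeriv
import Literature.NumberTheory.LFunctions.Zhang2022.Section2GammaFactor
import Literature.Analysis.Complex.CahenMellinSector
import HarnessLib

/-!
# Zhang (2022), §5 (5.6)–(5.7) ⇒ (5.10): the Mellin step "By the Mellin transform (see [1],
# Lemma 2)" — `ω = M[Gaussian]`, `x^{−s}ϑ*(1−s) = Γ(s)(2πix)^{−s}`, Fubini + Cahen–Mellin in the
# half-plane, and the passage to the boundary point `2πix`, kernel-checked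

Topic `Literature/NumberTheory/LFunctions/Zhang2022` (Landau–Siegel autopsy tree; verdict-neutral).
Y. Zhang, *Discrete mean estimates and the Landau–Siegel zero*, arXiv:2211.02515v1 (2022) — **an
unrefereed manuscript, a claimed result under adjudication** (cell pub-zhang: audit + repair census
of arXiv:2211.02515; no claim about Landau–Siegel).

Glossary: `\l` = `𝓛 = log D`; `𝓛₂ = 𝓛^{400}` ((2.15)); `s₀ = 1/2 + 2πit₀`; `ϑ*(1−s) = (2π)^{−s}Γ(s)e(−s/4)`
((5.5)); `e(x) = e^{2πix}`. Source text, §5 p. 10: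

> Let `Δ₁(x) = (1/2πi) ∫_{(3/2)} x^{−s} ϑ*(1−s) ω(s) ds`   (5.6)
> and `Δ(x) = Δ₁(x) e(x)`.   (5.7)
> […] Proof. By the Mellin transform (see [1], Lemma 2) we have
> `Δ₁(x) = ∫₀^∞ exp{(s₀ − 1)log y − 𝓛₂² log²y − 2πixy} dy`
> where the logarithm vanishes at `y = 1`. This yields, by substituting `y = e^u`,
> `Δ(x) = ∫_{−∞}^{∞} exp{s₀u − 𝓛₂²u² − 2πix(e^u − 1)} du.`   (5.10)

([1] = Balasubramanian–Conrey–Heath-Brown, J. reine angew. Math. 357 (1985), Lemma 2; not held.)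
This file PROVES that step, for free reals `L₂ > 0`, `t₀` and `x > 0`:

* `SmoothWeight.omega_eq_integral_gaussian` — **`ω` is the two-sided Laplace (Mellin) transform of
  the Gaussian**: `ω(s) = ∫_ℝ exp{−L₂²u² + (s − s₀)u} du` for EVERY complex `s` (so (2.15) is exactly
  `M[y ↦ exp{−s₀ log y − L₂² log² y}]`);
* `Lemma53.cpow_neg_mul_varthetaStar_eq` — `x^{−s}ϑ*(1−s) = Γ(s)·(2πix)^{−s}` (principal branch):
  the integrand of (5.6) is the Cahen–Mellin kernel at the purely imaginary point `2πix`;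
* `Lemma53.integral_Gamma_cpow_omega_eq` — **the Mellin step in the open half-plane**: for
  `Re z > 0` and `c > 0`, `∫_ℝ Γ(c+it) z^{−(c+it)} ω(c+it) dt = 2π ∫_ℝ exp{−L₂²u² − s₀u} e^{−z e^{−u}} du`
  (Gaussian representation, Fubini, and the tree's Cahen–Mellin integral in a sector
  `Literature.Analysis.Complex.integral_Gamma_mul_cpow_neg_eq`);
* `Lemma53.integral_Gamma_cpow_omega_eq_boundary` — the same identity AT `z = 2πix` (`Re z = 0`,
  where Fubini is unavailable termwise since `|Γ(c+it)(2πix)^{−(c+it)}| ≍ |t|^{c−1/2}`): both sides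
  are continuous at `2πix` within `{Re z > 0}` by dominated convergence
  (`continuousWithinAt_integral_Gamma_cpow_omega`: majorant `K(1+|t|)^N(|z₀|/2)^{−c}·|ω(c+it)|`,
  Gaussian in `t`; `continuousWithinAt_integral_exp_side`: `|e^{−e^{−u}z}| ≤ 1`), and `2πix` lies
  in the closure of the half-plane;
* `Lemma53.Delta1_56`, `Lemma53.Delta57` — (5.6), (5.7) as printed (line `Re s = 3/2`, `ds = i dt`);
  **`Lemma53.Delta57_eq_Delta510` — (5.6)–(5.7) ⇒ (5.10)**: `Δ₁(x)e(x) = ∫_ℝ exp{s₀u − L₂²u² −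
  2πix(e^u − 1)} du` (`= Lemma53.Delta510`, the definition used in `Section5Lemma53Phase`,
  `…CaseOne`, `…CaseTwo`, `Section5Lemma54DeltaDeriv`), with the branch of `ϑ*` and the sign of
  `e(x)` exactly as printed.

Together with `Section5Lemma53CaseOne`/`CaseTwo` this puts Lemma 5.3 (both cases, explicit
constants) and the definition chain (2.15)/(5.5)/(5.6)/(5.7)/(5.10) of `Δ` inside the kernel; the
manuscript's parameter values are not introduced. Nothing about Theorems 1–2 of the source is
stated or implied; nothing here bears on the cell's verdict on (8.24).

## References

* Y. Zhang, arXiv:2211.02515v1 (2022), §5 p. 10, (5.6), (5.7), (5.10).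
  [cite: Zhang2022LandauSiegel, §5 (5.6)–(5.7), (5.10)]
* E. C. Titchmarsh, *The Theory of the Riemann Zeta-Function*, §2.15 (Cahen–Mellin integral).
  [cite: Titchmarsh1986, §2.15]
-/

noncomputable section

open Complex Real Set MeasureTheory Filter Topology

namespace Literature.NumberTheory.LFunctions.Zhang2022

namespace SmoothWeight

/-- **`ω(s) = ∫_ℝ exp{−L₂²u² + (s − s₀)u} du` for every `s ∈ ℂ`** (`L₂ > 0`): the weight (2.15) is
the two-sided Laplace transform of the Gaussian `e^{−L₂²u²}` shifted by `s₀` — the structure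
behind "By the Mellin transform" in the proof of Lemma 5.3.
[cite: Zhang2022LandauSiegel, §2 (2.15); §5 Lemma 5.3 (proof)] -/
theorem omega_eq_integral_gaussian {L₂ : ℝ} (hL : 0 < L₂) (t₀ : ℝ) (s : ℂ) :
    omega L₂ t₀ s = ∫ u : ℝ, cexp (-(L₂ : ℂ) ^ 2 * (u : ℂ) ^ 2 + (s - s0 t₀) * u) := by
  have hb : (-(L₂ : ℂ) ^ 2).re < 0 := by
    have : (-(L₂ : ℂ) ^ 2) = ((-(L₂ ^ 2) : ℝ) : ℂ) := by push_cast; ring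
    rw [this, ofReal_re]
    nlinarith
  have h1 : ∀ u : ℝ, cexp (-(L₂ : ℂ) ^ 2 * (u : ℂ) ^ 2 + (s - s0 t₀) * u)
      = cexp (-(L₂ : ℂ) ^ 2 * (u : ℂ) ^ 2 + (s - s0 t₀) * u + 0) := by
    intro u; rw [add_zero]
  simp_rw [h1]
  rw [integral_cexp_quadratic hb, omega_def]
  have h2 : ((π : ℂ) / -(-(L₂ : ℂ) ^ 2)) ^ (1 / 2 : ℂ) = ((Real.sqrt π / L₂ : ℝ) : ℂ) := by
    rw [neg_neg, show ((π : ℂ) / (L₂ : ℂ) ^ 2) = ((π / L₂ ^ 2 : ℝ) : ℂ) by push_cast; ring,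
      show (1 / 2 : ℂ) = ((1 / 2 : ℝ) : ℂ) by push_cast; ring, ← ofReal_cpow (by positivity),
      ← Real.sqrt_eq_rpow, Real.sqrt_div' _ (by positivity), Real.sqrt_sq hL.le]
  have hL' : (L₂ : ℂ) ≠ 0 := ofReal_ne_zero.mpr hL.ne'
  rw [h2]
  congr 1
  rw [zero_sub, mul_neg, div_neg, neg_neg]

end SmoothWeight

namespace Lemma53

open SmoothWeight GammaFactor

/-- `log(2πx·i) = log(2πx) + iπ/2` for `x > 0`. [folklore] -/
private lemma log_two_pi_mul_I {x : ℝ} (hx : 0 < x) :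
    Complex.log (((2 * π * x : ℝ) : ℂ) * I) = ((Real.log (2 * π * x) : ℝ) : ℂ) + (π / 2) * I := by
  rw [Complex.log_ofReal_mul (by positivity) I_ne_zero, Complex.log_I]

/-- **`x^{−s} ϑ*(1−s) = Γ(s)·(2πix)^{−s}`** for `x > 0` (principal branch; `ϑ*(1−s) = (2π)^{−s}Γ(s)e(−s/4)`
of (5.5), the tree's `GammaFactor.varthetaStarOneSub`): the integrand of (5.6) is the Cahen–Mellin
kernel `Γ(s)z^{−s}` at `z = 2πix`. [cite: Zhang2022LandauSiegel, §5 (5.5)–(5.6)] -/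
theorem cpow_neg_mul_varthetaStar_eq {x : ℝ} (hx : 0 < x) (s : ℂ) :
    (x : ℂ) ^ (-s) * varthetaStarOneSub s
      = Complex.Gamma s * ((((2 * π * x : ℝ) : ℂ) * I) ^ (-s)) := by
  have hx0 : (x : ℂ) ≠ 0 := ofReal_ne_zero.mpr hx.ne'
  have h2π : ((2 * π : ℂ)) ≠ 0 := by
    have : (0 : ℝ) < 2 * π := by positivity
    exact_mod_cast this.ne'
  have hz : (((2 * π * x : ℝ) : ℂ) * I) ≠ 0 := mul_ne_zero (by exact_mod_cast (by positivity : (0:ℝ) < 2 * π * x).ne') I_ne_zero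
  have e1 : (x : ℂ) ^ (-s) = cexp (((Real.log x : ℝ) : ℂ) * -s) := by
    rw [Complex.cpow_def_of_ne_zero hx0, ← Complex.ofReal_log hx.le]
  have e2 : (2 * π : ℂ) ^ (-s) = cexp (((Real.log (2 * π) : ℝ) : ℂ) * -s) := by
    rw [Complex.cpow_def_of_ne_zero h2π, show (2 * π : ℂ) = ((2 * π : ℝ) : ℂ) by push_cast; ring,
      ← Complex.ofReal_log (by positivity)]
  have e3 : ((((2 * π * x : ℝ) : ℂ) * I) ^ (-s))
      = cexp ((((Real.log (2 * π * x) : ℝ) : ℂ) + (π / 2) * I) * -s) := by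
    rw [Complex.cpow_def_of_ne_zero hz, log_two_pi_mul_I hx]
  rw [varthetaStarOneSub, e1, e2, e3, Real.log_mul (by positivity) hx.ne', ofReal_add]
  have key : cexp ((((Real.log (2 * π) : ℝ) : ℂ) + ((Real.log x : ℝ) : ℂ) + (π / 2) * I) * -s)
      = cexp (((Real.log x : ℝ) : ℂ) * -s) * cexp (((Real.log (2 * π) : ℝ) : ℂ) * -s)
        * cexp (-(π * s / 2) * I) := by
    rw [← Complex.exp_add, ← Complex.exp_add]
    congr 1
    ring
  rw [key]
  ring

/-! ## The Mellin step in the open half-plane `Re z > 0` -/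

/-- `z^{−s}·e^{su} = (e^{−u}z)^{−s}` for `z ≠ 0` and real `u` (principal branch: scaling by the
positive real `e^{−u}` does not move the argument). [folklore] -/
private lemma cpow_neg_mul_exp_eq {z : ℂ} (hz : z ≠ 0) (s : ℂ) (u : ℝ) :
    z ^ (-s) * cexp (s * u) = (((Real.exp (-u) : ℝ) : ℂ) * z) ^ (-s) := by
  have hr : 0 < Real.exp (-u) := Real.exp_pos _
  have hz' : ((Real.exp (-u) : ℝ) : ℂ) * z ≠ 0 := mul_ne_zero (ofReal_ne_zero.mpr hr.ne') hz
  rw [Complex.cpow_def_of_ne_zero hz, Complex.cpow_def_of_ne_zero hz',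
    Complex.log_ofReal_mul hr hz, Real.log_exp, ← Complex.exp_add]
  congr 1
  push_cast
  ring

/-- The norm of the two-variable integrand: `‖Γ(c+it) z^{−(c+it)} e^{−L₂²u² + (c+it−s₀)u}‖ =
‖Γ(c+it) z^{−(c+it)}‖ · e^{(c − 1/2)u − L₂²u²}`. [folklore] -/
private lemma norm_integrand_eq (L₂ t₀ c t u : ℝ) (z : ℂ) :
    ‖Complex.Gamma (c + t * I) * z ^ (-((c : ℂ) + t * I))
        * cexp (-(L₂ : ℂ) ^ 2 * (u : ℂ) ^ 2 + ((c : ℂ) + t * I - s0 t₀) * u)‖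
      = ‖Complex.Gamma (c + t * I) * z ^ (-((c : ℂ) + t * I))‖
        * Real.exp ((c - 1 / 2) * u - L₂ ^ 2 * u ^ 2) := by
  rw [norm_mul, Complex.norm_exp]
  congr 2
  rw [s0_def]
  have : (-(L₂ : ℂ) ^ 2 * (u : ℂ) ^ 2 + ((c : ℂ) + t * I - (1 / 2 + 2 * π * t₀ * I)) * u)
      = (((c - 1 / 2) * u - L₂ ^ 2 * u ^ 2 : ℝ) : ℂ) + ((t - 2 * π * t₀) * u : ℝ) * I := by
    push_cast; ring
  rw [this, Complex.add_re, ofReal_re, re_ofReal_mul, Complex.I_re, mul_zero, add_zero]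

/-- **The Mellin step of (5.6) ⇒ (5.10) in the open half-plane**: for `L₂ > 0`, `c > 0` and
`Re z > 0`,
`∫_ℝ Γ(c+it) z^{−(c+it)} ω(c+it) dt = 2π ∫_ℝ exp{−L₂²u² − s₀u} exp{−z e^{−u}} du`
— insert `ω(c+it) = ∫ exp{−L₂²u² + (c+it−s₀)u} du`, swap the integrals (absolutely convergent for
`Re z > 0`), use `z^{−s}e^{su} = (e^{−u}z)^{−s}` and the Cahen–Mellin integral
`∫ Γ(c+it)(e^{−u}z)^{−(c+it)} dt = 2π exp{−e^{−u}z}`. At `z = 2πix` (after `u ↦ −u` and the factor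
`e(x)`) the right side is (5.10); the boundary passage is `integral_Gamma_cpow_omega_eq_boundary`.
[cite: Zhang2022LandauSiegel, §5 Lemma 5.3 (proof, "By the Mellin transform"), (5.6), (5.10)]
[cite: Titchmarsh1986, §2.15] -/
theorem integral_Gamma_cpow_omega_eq {L₂ : ℝ} (hL : 0 < L₂) (t₀ : ℝ) {c : ℝ} (hc : 0 < c)
    {z : ℂ} (hz : 0 < z.re) :
    ∫ t : ℝ, Complex.Gamma (c + t * I) * z ^ (-((c : ℂ) + t * I)) * omega L₂ t₀ (c + t * I)
      = 2 * π * ∫ u : ℝ, cexp (-(L₂ : ℂ) ^ 2 * (u : ℂ) ^ 2 - s0 t₀ * u)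
          * cexp (-(((Real.exp (-u) : ℝ) : ℂ) * z)) := by
  have hz0 : z ≠ 0 := fun h => by rw [h, Complex.zero_re] at hz; exact lt_irrefl _ hz
  -- the two-variable integrand
  set F : ℝ → ℝ → ℂ := fun t u => Complex.Gamma (c + t * I) * z ^ (-((c : ℂ) + t * I))
    * cexp (-(L₂ : ℂ) ^ 2 * (u : ℂ) ^ 2 + ((c : ℂ) + t * I - s0 t₀) * u) with hF
  -- Step 1: insert the Gaussian representation of `ω`
  have h1 : ∀ t : ℝ, Complex.Gamma (c + t * I) * z ^ (-((c : ℂ) + t * I)) * omega L₂ t₀ (c + t * I)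
      = ∫ u : ℝ, F t u := by
    intro t
    rw [omega_eq_integral_gaussian hL t₀, ← integral_const_mul]
  simp_rw [h1]
  -- Step 2: integrability on the product
  obtain ⟨R, hR, hball, bound, hbi, hbd⟩ :=
    Literature.Analysis.Complex.exists_bound_Gamma_mul_cpow_neg hc hz
  have hg1 : Integrable fun t : ℝ => ‖Complex.Gamma (c + t * I) * z ^ (-((c : ℂ) + t * I))‖ := by
    refine hbi.mono' ?_ (Eventually.of_forall fun t => ?_)
    · exact (Literature.Analysis.Complex.continuous_Gamma_mul_cpow_neg hc hz0).norm.aestronglyMeasurable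
    · rw [norm_norm]; exact hbd t z (Metric.mem_ball_self hR)
  have hg2 : Integrable fun u : ℝ => Real.exp ((c - 1 / 2) * u - L₂ ^ 2 * u ^ 2) := by
    have hb : (-(L₂ : ℂ) ^ 2).re < 0 := by
      have : (-(L₂ : ℂ) ^ 2) = ((-(L₂ ^ 2) : ℝ) : ℂ) := by push_cast; ring
      rw [this, ofReal_re]; nlinarith
    have hg : Integrable fun u : ℝ => cexp (-(L₂ : ℂ) ^ 2 * (u : ℂ) ^ 2 + ((c - 1 / 2 : ℝ) : ℂ) * u + 0) :=
      integrable_cexp_quadratic' hb _ _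
    refine (hg.norm).congr (Eventually.of_forall fun u => ?_)
    simp only
    rw [Complex.norm_exp]
    congr 1
    have : (-(L₂ : ℂ) ^ 2 * (u : ℂ) ^ 2 + ((c - 1 / 2 : ℝ) : ℂ) * u + 0)
        = (((c - 1 / 2) * u - L₂ ^ 2 * u ^ 2 : ℝ) : ℂ) := by push_cast; ring
    rw [this, ofReal_re]
  have hcontF : Continuous (Function.uncurry F) := by
    simp only [hF]
    have hA : Continuous fun p : ℝ × ℝ => Complex.Gamma (c + p.1 * I) * z ^ (-((c : ℂ) + p.1 * I)) :=
      (Literature.Analysis.Complex.continuous_Gamma_mul_cpow_neg hc hz0).comp continuous_fst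
    have hB : Continuous fun p : ℝ × ℝ =>
        cexp (-(L₂ : ℂ) ^ 2 * (p.2 : ℂ) ^ 2 + ((c : ℂ) + p.1 * I - s0 t₀) * p.2) := by
      unfold s0; fun_prop
    exact hA.mul hB
  have hint : Integrable (Function.uncurry F) ((volume : Measure ℝ).prod volume) := by
    refine (hg1.mul_prod hg2).mono' hcontF.aestronglyMeasurable (Eventually.of_forall fun p => ?_)
    simp only [Function.uncurry, hF]
    rw [norm_integrand_eq]
  -- Step 3: swap
  rw [integral_integral_swap hint]
  -- Step 4: the inner `t`-integral is a Cahen–Mellin integral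
  have h4 : ∀ u : ℝ, ∫ t : ℝ, F t u
      = 2 * π * (cexp (-(L₂ : ℂ) ^ 2 * (u : ℂ) ^ 2 - s0 t₀ * u)
          * cexp (-(((Real.exp (-u) : ℝ) : ℂ) * z))) := by
    intro u
    have hzu : 0 < ((((Real.exp (-u) : ℝ) : ℂ) * z)).re := by
      rw [re_ofReal_mul]; exact mul_pos (Real.exp_pos _) hz
    have e1 : ∀ t : ℝ, F t u = cexp (-(L₂ : ℂ) ^ 2 * (u : ℂ) ^ 2 - s0 t₀ * u)
        * (Complex.Gamma (c + t * I) * (((Real.exp (-u) : ℝ) : ℂ) * z) ^ (-((c : ℂ) + t * I))) := by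
      intro t
      simp only [hF]
      rw [← cpow_neg_mul_exp_eq hz0]
      rw [show -(L₂ : ℂ) ^ 2 * (u : ℂ) ^ 2 + ((c : ℂ) + t * I - s0 t₀) * u
          = (-(L₂ : ℂ) ^ 2 * (u : ℂ) ^ 2 - s0 t₀ * u) + ((c : ℂ) + t * I) * u by ring,
        Complex.exp_add]
      ring
    simp_rw [e1]
    rw [integral_const_mul, Literature.Analysis.Complex.integral_Gamma_mul_cpow_neg_eq hc hzu]
    ring
  simp_rw [h4]
  rw [integral_const_mul]


/-! ## The passage to the boundary point `z = 2πix` -/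

/-- The modulus of `ω` on the vertical line `Re s = c`:
`‖ω(c+it)‖ = (√π/L₂)·exp{((c−1/2)² − (t−2πt₀)²)/(4L₂²)}`. [cite: Zhang2022LandauSiegel, §2 (2.15)] -/
theorem norm_omega_vertical {L₂ : ℝ} (hL : 0 < L₂) (t₀ c t : ℝ) :
    ‖omega L₂ t₀ (c + t * I)‖
      = Real.sqrt π / L₂ * Real.exp (((c - 1 / 2) ^ 2 - (t - 2 * π * t₀) ^ 2) / (4 * L₂ ^ 2)) := by
  rw [omega_def, norm_mul, Complex.norm_real, Real.norm_of_nonneg (by positivity), Complex.norm_exp]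
  congr 2
  rw [s0_def]
  have hL' : (L₂ : ℂ) ≠ 0 := ofReal_ne_zero.mpr hL.ne'
  have : (((c : ℂ) + t * I - (1 / 2 + 2 * π * t₀ * I)) ^ 2 / (4 * (L₂ : ℂ) ^ 2))
      = ((((c - 1 / 2) ^ 2 - (t - 2 * π * t₀) ^ 2) / (4 * L₂ ^ 2) : ℝ) : ℂ)
        + ((2 * (c - 1 / 2) * (t - 2 * π * t₀) / (4 * L₂ ^ 2) : ℝ) : ℂ) * I := by
    push_cast
    field_simp
    ring_nf
    rw [I_sq]
    ring
  rw [this, Complex.add_re, ofReal_re, re_ofReal_mul, Complex.I_re, mul_zero, add_zero]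

/-- `(1 + |t|)^N ≤ e^{N|t|}` for `N ≥ 0`. [folklore] -/
private lemma one_add_abs_rpow_le (t : ℝ) {N : ℝ} (hN : 0 ≤ N) :
    (1 + |t|) ^ N ≤ Real.exp (N * |t|) := by
  have h1 : 1 + |t| ≤ Real.exp |t| := by
    have := Real.add_one_le_exp |t|; linarith
  calc (1 + |t|) ^ N ≤ (Real.exp |t|) ^ N := Real.rpow_le_rpow (by positivity) h1 hN
    _ = Real.exp (N * |t|) := by rw [← Real.exp_mul, mul_comm]

/-- `t ↦ e^{N|t|}·e^{−(t−a)²/(4L₂²)}` is integrable (`L₂ > 0`). [folklore] -/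
private lemma integrable_exp_abs_mul_gaussian {L₂ : ℝ} (hL : 0 < L₂) (N a : ℝ) :
    Integrable fun t : ℝ => Real.exp (N * |t|) * Real.exp (-((t - a) ^ 2) / (4 * L₂ ^ 2)) := by
  have hL' : 1 / (2 * L₂) ≠ 0 := by positivity
  -- `e^{N|t|} ≤ e^{Nt} + e^{−Nt}`, and each product is `exp(linear − (t/(2L₂))²)·const`
  have key : ∀ σ : ℝ, Integrable fun t : ℝ =>
      Real.exp (σ * t) * Real.exp (-((t - a) ^ 2) / (4 * L₂ ^ 2)) := by
    intro σ
    have h := (integrable_exp_lin_sub_sq hL' (σ + a / (2 * L₂ ^ 2))).const_mul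
      (Real.exp (-(a ^ 2) / (4 * L₂ ^ 2)))
    refine h.congr (Eventually.of_forall fun t => ?_)
    simp only
    rw [← Real.exp_add, ← Real.exp_add]
    congr 1
    field_simp
    ring
  refine ((key N).add (key (-N))).mono' (by fun_prop) (Eventually.of_forall fun t => ?_)
  have hpos : 0 ≤ Real.exp (N * |t|) * Real.exp (-((t - a) ^ 2) / (4 * L₂ ^ 2)) := by positivity
  rw [Real.norm_of_nonneg hpos, Pi.add_apply, ← add_mul]
  gcongr
  rcases le_or_gt 0 t with ht | ht
  · rw [abs_of_nonneg ht]; linarith [Real.exp_pos (-N * t)]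
  · rw [abs_of_neg ht, show N * -t = -N * t by ring]; linarith [Real.exp_pos (N * t)]

/-- **Continuity of the Mellin side up to the boundary**: for `L₂ > 0`, `c > 0` and `z₀ ≠ 0` with
`Re z₀ ≥ 0`, `z ↦ ∫ Γ(c+it) z^{−(c+it)} ω(c+it) dt` is continuous at `z₀` within `{Re z > 0}`
(dominated convergence: on `{Re z > 0} ∩ B(z₀, |z₀|/2)`, `‖Γ(c+it)z^{−(c+it)}‖ ≤ K(1+|t|)^N (|z₀|/2)^{−c}`
and `ω(c+it)` is Gaussian in `t`). [cite: Zhang2022LandauSiegel, §5 (5.6)] [cite: Titchmarsh1986, §2.15] -/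
theorem continuousWithinAt_integral_Gamma_cpow_omega {L₂ : ℝ} (hL : 0 < L₂) (t₀ : ℝ) {c : ℝ}
    (hc : 0 < c) {z₀ : ℂ} (hz₀ : z₀ ≠ 0) (hre : 0 ≤ z₀.re) :
    ContinuousWithinAt
      (fun z : ℂ => ∫ t : ℝ, Complex.Gamma (c + t * I) * z ^ (-((c : ℂ) + t * I)) * omega L₂ t₀ (c + t * I))
      {z : ℂ | 0 < z.re} z₀ := by
  obtain ⟨K, N, hK, hN, hΓ⟩ := Literature.Analysis.Complex.exists_norm_Gamma_vertical_le hc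
  set r : ℝ := ‖z₀‖ / 2 with hr
  have hr0 : 0 < r := by rw [hr]; exact half_pos (norm_pos_iff.mpr hz₀)
  -- the neighbourhood `{Re z > 0} ∩ ball z₀ r`
  have hnb : ∀ᶠ z in 𝓝[{z : ℂ | 0 < z.re}] z₀, 0 < z.re ∧ z ∈ Metric.ball z₀ r := by
    filter_upwards [self_mem_nhdsWithin, nhdsWithin_le_nhds (Metric.ball_mem_nhds z₀ hr0)]
      with z hz hz'
    exact ⟨hz, hz'⟩
  have hzr : ∀ z ∈ Metric.ball z₀ r, r ≤ ‖z‖ := by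
    intro z hz
    have h1 : ‖z₀‖ - ‖z‖ ≤ ‖z₀ - z‖ := norm_sub_norm_le _ _
    have h2 : ‖z₀ - z‖ < r := by rw [← dist_eq_norm, dist_comm]; exact hz
    rw [hr] at h2 ⊢; linarith
  -- the dominating function
  set C : ℝ := K * r ^ (-c) * (Real.sqrt π / L₂ * Real.exp ((c - 1 / 2) ^ 2 / (4 * L₂ ^ 2))) with hC
  set bound : ℝ → ℝ := fun t => C * (Real.exp (N * |t|)
      * Real.exp (-((t - 2 * π * t₀) ^ 2) / (4 * L₂ ^ 2))) with hbound
  have hbi : Integrable bound := (integrable_exp_abs_mul_gaussian hL N (2 * π * t₀)).const_mul C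
  have hcontω : Continuous fun t : ℝ => omega L₂ t₀ (c + t * I) := by unfold omega s0; fun_prop
  refine continuousWithinAt_of_dominated (bound := bound) ?_ ?_ hbi ?_
  · -- measurability near `z₀`
    filter_upwards [hnb] with z hz
    have hz0 : z ≠ 0 := fun h => by rw [h, Complex.zero_re] at hz; exact lt_irrefl _ hz.1
    exact ((Literature.Analysis.Complex.continuous_Gamma_mul_cpow_neg hc hz0).mul hcontω).aestronglyMeasurable
  · -- domination near `z₀`
    filter_upwards [hnb] with z hz
    have hz0 : z ≠ 0 := fun h => by rw [h, Complex.zero_re] at hz; exact lt_irrefl _ hz.1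
    refine Eventually.of_forall fun t => ?_
    rw [norm_mul, norm_mul, Literature.Analysis.Complex.norm_cpow_neg_add_mul_I_of_ne_zero hz0,
      norm_omega_vertical hL]
    have harg : |arg z| ≤ π / 2 := Complex.abs_arg_le_pi_div_two_iff.mpr hz.1.le
    have h1 : Real.exp (t * arg z) ≤ Real.exp (π / 2 * |t|) := by
      apply Real.exp_le_exp.mpr
      have := abs_mul t (arg z)
      have h' : t * arg z ≤ |t * arg z| := le_abs_self _
      rw [abs_mul] at h'
      nlinarith [abs_nonneg t, abs_nonneg (arg z)]
    have h2 : ‖z‖ ^ (-c) ≤ r ^ (-c) :=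
      Real.rpow_le_rpow_of_nonpos hr0 (hzr z hz.2) (by linarith)
    have h3 := hΓ t
    have h4 : Real.exp (((c - 1 / 2) ^ 2 - (t - 2 * π * t₀) ^ 2) / (4 * L₂ ^ 2))
        = Real.exp ((c - 1 / 2) ^ 2 / (4 * L₂ ^ 2))
          * Real.exp (-((t - 2 * π * t₀) ^ 2) / (4 * L₂ ^ 2)) := by
      rw [← Real.exp_add]; congr 1; ring
    have h5 := one_add_abs_rpow_le t hN
    rw [h4, hbound]
    simp only [hC]
    -- assemble the product bound
    have hA : ‖Complex.Gamma (c + t * I)‖ * (‖z‖ ^ (-c) * Real.exp (t * arg z))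
        ≤ K * Real.exp (N * |t|) * r ^ (-c) := by
      calc ‖Complex.Gamma (c + t * I)‖ * (‖z‖ ^ (-c) * Real.exp (t * arg z))
          ≤ (K * (1 + |t|) ^ N * Real.exp (-(π / 2 * |t|))) * (r ^ (-c) * Real.exp (π / 2 * |t|)) := by
            apply mul_le_mul h3 (mul_le_mul h2 h1 (Real.exp_pos _).le (by positivity))
              (by positivity) (by positivity)
        _ = K * (1 + |t|) ^ N * r ^ (-c) * (Real.exp (-(π / 2 * |t|)) * Real.exp (π / 2 * |t|)) := by
            ring
        _ = K * (1 + |t|) ^ N * r ^ (-c) := by rw [← Real.exp_add, neg_add_cancel, Real.exp_zero, mul_one]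
        _ ≤ K * Real.exp (N * |t|) * r ^ (-c) := by gcongr
    have hB : 0 ≤ Real.sqrt π / L₂ * (Real.exp ((c - 1 / 2) ^ 2 / (4 * L₂ ^ 2))
        * Real.exp (-((t - 2 * π * t₀) ^ 2) / (4 * L₂ ^ 2))) := by positivity
    calc ‖Complex.Gamma (c + t * I)‖ * (‖z‖ ^ (-c) * Real.exp (t * arg z))
          * (Real.sqrt π / L₂ * (Real.exp ((c - 1 / 2) ^ 2 / (4 * L₂ ^ 2))
            * Real.exp (-((t - 2 * π * t₀) ^ 2) / (4 * L₂ ^ 2))))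
        ≤ (K * Real.exp (N * |t|) * r ^ (-c))
          * (Real.sqrt π / L₂ * (Real.exp ((c - 1 / 2) ^ 2 / (4 * L₂ ^ 2))
            * Real.exp (-((t - 2 * π * t₀) ^ 2) / (4 * L₂ ^ 2)))) :=
          mul_le_mul_of_nonneg_right hA hB
      _ = _ := by ring
  · -- pointwise continuity in `z` at `z₀`
    refine Eventually.of_forall fun t => ?_
    have hslit : z₀ ∈ Complex.slitPlane := by
      rw [Complex.mem_slitPlane_iff]
      rcases hre.eq_or_lt with h | h
      · right
        intro him
        apply hz₀
        apply Complex.ext <;> simp [← h, him]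
      · exact Or.inl h
    have hcz : ContinuousAt (fun z : ℂ => z ^ (-((c : ℂ) + t * I))) z₀ := continuousAt_cpow_const hslit
    exact ((continuousAt_const.mul hcz).mul continuousAt_const).continuousWithinAt

/-- **Continuity of the (5.10) side up to the boundary**: for `L₂ > 0`,
`z ↦ ∫ exp{−L₂²u² − s₀u} exp{−e^{−u}z} du` is continuous at every `z₀` within `{Re z > 0}`
(`|exp{−e^{−u}z}| ≤ 1` there). [cite: Zhang2022LandauSiegel, §5 (5.10)] -/
theorem continuousWithinAt_integral_exp_side {L₂ : ℝ} (hL : 0 < L₂) (t₀ : ℝ) (z₀ : ℂ) :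
    ContinuousWithinAt
      (fun z : ℂ => ∫ u : ℝ, cexp (-(L₂ : ℂ) ^ 2 * (u : ℂ) ^ 2 - s0 t₀ * u)
        * cexp (-(((Real.exp (-u) : ℝ) : ℂ) * z)))
      {z : ℂ | 0 < z.re} z₀ := by
  set bound : ℝ → ℝ := fun u => Real.exp (-(1 / 2) * u - L₂ ^ 2 * u ^ 2) with hbound
  have hbi : Integrable bound := integrable_exp_lin_sub_sq hL.ne' (-(1 / 2))
  refine continuousWithinAt_of_dominated (bound := bound) ?_ ?_ hbi ?_
  · refine Eventually.of_forall fun z => ?_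
    have : Continuous fun u : ℝ => cexp (-(L₂ : ℂ) ^ 2 * (u : ℂ) ^ 2 - s0 t₀ * u)
        * cexp (-(((Real.exp (-u) : ℝ) : ℂ) * z)) := by unfold s0; fun_prop
    exact this.aestronglyMeasurable
  · filter_upwards [self_mem_nhdsWithin] with z hz
    refine Eventually.of_forall fun u => ?_
    rw [norm_mul, Complex.norm_exp, Complex.norm_exp]
    have h1 : (-(L₂ : ℂ) ^ 2 * (u : ℂ) ^ 2 - s0 t₀ * u).re = -(1 / 2) * u - L₂ ^ 2 * u ^ 2 := by
      rw [s0_def]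
      have : (-(L₂ : ℂ) ^ 2 * (u : ℂ) ^ 2 - (1 / 2 + 2 * π * t₀ * I) * u)
          = ((-(1 / 2) * u - L₂ ^ 2 * u ^ 2 : ℝ) : ℂ) + ((-(2 * π * t₀ * u) : ℝ) : ℂ) * I := by
        push_cast; ring
      rw [this, Complex.add_re, ofReal_re, re_ofReal_mul, Complex.I_re, mul_zero, add_zero]
    have h2 : (-(((Real.exp (-u) : ℝ) : ℂ) * z)).re ≤ 0 := by
      rw [Complex.neg_re, re_ofReal_mul]
      have : 0 ≤ Real.exp (-u) * z.re := mul_nonneg (Real.exp_pos _).le (le_of_lt hz)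
      linarith
    rw [h1, hbound]
    have : Real.exp ((-(((Real.exp (-u) : ℝ) : ℂ) * z)).re) ≤ 1 := Real.exp_le_one_iff.mpr h2
    have h0 : 0 ≤ Real.exp (-(1 / 2) * u - L₂ ^ 2 * u ^ 2) := (Real.exp_pos _).le
    nlinarith
  · refine Eventually.of_forall fun u => ?_
    have : Continuous fun z : ℂ => cexp (-(L₂ : ℂ) ^ 2 * (u : ℂ) ^ 2 - s0 t₀ * u)
        * cexp (-(((Real.exp (-u) : ℝ) : ℂ) * z)) := by fun_prop
    exact this.continuousAt.continuousWithinAt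

/-- **The Mellin step at the boundary point**: for `L₂ > 0`, `c > 0`, `x > 0`,
`∫_ℝ Γ(c+it)(2πix)^{−(c+it)} ω(c+it) dt = 2π ∫_ℝ exp{−L₂²u² − s₀u} exp{−2πix e^{−u}} du`
(the half-plane identity `integral_Gamma_cpow_omega_eq` passes to `z = 2πix` by continuity of both
sides within `{Re z > 0}`). [cite: Zhang2022LandauSiegel, §5 Lemma 5.3 (proof), (5.6), (5.10)] -/
theorem integral_Gamma_cpow_omega_eq_boundary {L₂ : ℝ} (hL : 0 < L₂) (t₀ : ℝ) {c : ℝ} (hc : 0 < c)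
    {x : ℝ} (hx : 0 < x) :
    ∫ t : ℝ, Complex.Gamma (c + t * I) * ((((2 * π * x : ℝ) : ℂ) * I) ^ (-((c : ℂ) + t * I)))
        * omega L₂ t₀ (c + t * I)
      = 2 * π * ∫ u : ℝ, cexp (-(L₂ : ℂ) ^ 2 * (u : ℂ) ^ 2 - s0 t₀ * u)
          * cexp (-(((Real.exp (-u) : ℝ) : ℂ) * ((((2 * π * x : ℝ) : ℂ) * I)))) := by
  set z₀ : ℂ := (((2 * π * x : ℝ) : ℂ) * I) with hz₀
  have hz₀ne : z₀ ≠ 0 := mul_ne_zero (by exact_mod_cast (by positivity : (0:ℝ) < 2 * π * x).ne') I_ne_zero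
  have hz₀re : z₀.re = 0 := by simp [hz₀]
  -- `z₀` is in the closure of the open half-plane
  have hmem : z₀ ∈ closure {z : ℂ | 0 < z.re} := by
    rw [Complex.closure_setOf_lt_re]
    simp [hz₀re]
  haveI : (𝓝[{z : ℂ | 0 < z.re}] z₀).NeBot := mem_closure_iff_nhdsWithin_neBot.mp hmem
  have T1 := (continuousWithinAt_integral_Gamma_cpow_omega hL t₀ hc hz₀ne (le_of_eq hz₀re.symm)).tendsto
  have T2 := ((continuousWithinAt_integral_exp_side hL t₀ z₀).tendsto).const_mul (2 * (π : ℂ))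
  have heq : (fun z : ℂ => ∫ t : ℝ, Complex.Gamma (c + t * I) * z ^ (-((c : ℂ) + t * I))
        * omega L₂ t₀ (c + t * I))
      =ᶠ[𝓝[{z : ℂ | 0 < z.re}] z₀]
      (fun z : ℂ => 2 * (π : ℂ) * ∫ u : ℝ, cexp (-(L₂ : ℂ) ^ 2 * (u : ℂ) ^ 2 - s0 t₀ * u)
        * cexp (-(((Real.exp (-u) : ℝ) : ℂ) * z))) := by
    filter_upwards [self_mem_nhdsWithin] with z hz
    exact integral_Gamma_cpow_omega_eq hL t₀ hc hz
  exact tendsto_nhds_unique (T1.congr' heq) T2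

/-! ## (5.6)–(5.7) ⇒ (5.10) -/

/-- **(5.6)**: `Δ₁(x) = (1/2πi)∫_{(3/2)} x^{−s}ϑ*(1−s)ω(s) ds`, as the line integral
`(1/2π)∫_ℝ x^{−(3/2+it)} ϑ*(1−(3/2+it)) ω(3/2+it) dt` (`ds = i dt`).
[cite: Zhang2022LandauSiegel, §5 (5.6)] -/
def Delta1_56 (L₂ t₀ x : ℝ) : ℂ :=
  1 / (2 * π) * ∫ t : ℝ, (x : ℂ) ^ (-((3 / 2 : ℂ) + t * I))
    * varthetaStarOneSub ((3 / 2 : ℂ) + t * I) * omega L₂ t₀ ((3 / 2 : ℂ) + t * I)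

/-- **(5.7)**: `Δ(x) = Δ₁(x)e(x)`, `e(x) = e^{2πix}`. [cite: Zhang2022LandauSiegel, §5 (5.7)] -/
def Delta57 (L₂ t₀ x : ℝ) : ℂ := Delta1_56 L₂ t₀ x * cexp (2 * π * I * x)

/-- **(5.6)–(5.7) ⇒ (5.10)**: for `L₂ > 0` and `x > 0`, the `Δ` of (5.6)–(5.7) equals the integral
(5.10), `∫_ℝ exp{s₀u − L₂²u² − 2πix(e^u − 1)} du` (`Lemma53.Delta510`) — the step "By the Mellin
transform (see [1], Lemma 2) … This yields, by substituting `y = e^u`, (5.10)", with the branch of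
`ϑ*` and the sign of `e(x)` as printed. [cite: Zhang2022LandauSiegel, §5 Lemma 5.3 (proof), (5.6), (5.7), (5.10)] -/
theorem Delta57_eq_Delta510 {L₂ : ℝ} (hL : 0 < L₂) (t₀ : ℝ) {x : ℝ} (hx : 0 < x) :
    Delta57 L₂ t₀ x = Delta510 L₂ t₀ x := by
  have hc : (0 : ℝ) < 3 / 2 := by norm_num
  -- (5.6) is the Mellin side at `z₀ = 2πix`
  have h1 : ∀ t : ℝ, (x : ℂ) ^ (-((3 / 2 : ℂ) + t * I)) * varthetaStarOneSub ((3 / 2 : ℂ) + t * I)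
      * omega L₂ t₀ ((3 / 2 : ℂ) + t * I)
      = Complex.Gamma ((3 / 2 : ℝ) + t * I) * ((((2 * π * x : ℝ) : ℂ) * I) ^ (-(((3 / 2 : ℝ) : ℂ) + t * I)))
        * omega L₂ t₀ ((3 / 2 : ℝ) + t * I) := by
    intro t
    rw [cpow_neg_mul_varthetaStar_eq hx]
    push_cast
    ring_nf
  have h2 := integral_Gamma_cpow_omega_eq_boundary hL t₀ hc hx
  rw [Delta57, Delta1_56]
  simp_rw [h1]
  rw [h2]
  -- substitute `u ↦ −u` and absorb `e(x)`
  have h3 : ∫ u : ℝ, cexp (-(L₂ : ℂ) ^ 2 * (u : ℂ) ^ 2 - s0 t₀ * u)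
        * cexp (-(((Real.exp (-u) : ℝ) : ℂ) * ((((2 * π * x : ℝ) : ℂ) * I))))
      = ∫ u : ℝ, cexp (-(L₂ : ℂ) ^ 2 * (u : ℂ) ^ 2 + s0 t₀ * u)
        * cexp (-(((Real.exp u : ℝ) : ℂ) * ((((2 * π * x : ℝ) : ℂ) * I)))) := by
    rw [← integral_neg_eq_self _ volume]
    congr 1
    funext u
    push_cast
    ring_nf
  have hπ : (π : ℂ) ≠ 0 := ofReal_ne_zero.mpr Real.pi_pos.ne'
  have hcancel : ∀ X : ℂ, 1 / (2 * (π : ℂ)) * (2 * π * X) = X := fun X => by field_simp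
  rw [h3, hcancel, Delta510, ← integral_mul_const]
  congr 1
  funext u
  rw [phase_def, s0_def, ← Complex.exp_add, ← Complex.exp_add]
  congr 1
  push_cast
  ring

end Lemma53

end Literature.NumberTheory.LFunctions.Zhang2022
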